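import Literature.NumberTheory.Automorphic.Liu2021.Def411IrreducibleOfLemD1AsPrinted
import Literature.NumberTheory.QuadraticForms.QuadraticFormIsotropicOfFiveLe
import Mathlib.RingTheory.Trace.Basic
import HarnessLib

/-!
# [Liu2021, Lem. D.1 (1)] at `n ≥ 3`: the hermitian space `(E_vⁿ, J_V ⊗ (a))` of the local datum is ISOTROPIC
# (trace form over `F_v` + u-invariant `≤ 4`)

Topic `NumberTheory/Automorphic/Liu2021`; namespaces `Literature.RepresentationTheory.Liu2021.OscillatorStandingData`
(dot-notation API of the tree's standing-data structure, declared by absolute name), `Literature.NumberTheory.Automorphic.Liu2021.LemD1OfPlace`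
(the local model `E_v = E ⊗_F F_v`) and `Literature.NumberTheory.Automorphic.Liu2021.Def411WeilCarriers` (the as-printed datum
`localLemD1Data … v`).  KERNEL ONLY: theorems, no definition, no named fact, no `sorry`.  Nothing of [Liu2021] is asserted.

**What is proved.**  In [Liu2021, App. D Lemma D.1 (1)] the non-vanishing of the local theta lift `ω(μ, ε, χ)` holds for
every `χ` UNLESS «`V` is anisotropic (in particular `n = 2`)»; the stable-range input of [MoeglinVignerasWaldspurger1987,
Chap. 3 IV.2] is that a hermitian space of rank `n ≥ 3` over the quadratic `F_v`-algebra `E_v` has an isotropic vector.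
Mechanism (the underlying `F_v`-space `|W|` of an `ε`-hermitian space, [MoeglinVignerasWaldspurger1987, Chap. 1 I.1];
trace ∕ transfer forms, Scharlau Ch. 10 §1): `h(x, x)` is fixed by the involution `c ⊗ 1`, so
`x ↦ Tr_{E_v/F_v} h(x, x) = 2 · h(x, x)` is an `F_v`-quadratic form on the `2n ≥ 6`-dimensional `F_v`-space `E_vⁿ`;
every quadratic form in `≥ 5` variables over `F_v` has a non-trivial zero (u-invariant `4`, [Lam2005, Ch. VI Thm 2.12],
tree `QuadraticForms.not_anisotropic_of_five_le_finrank_adicCompletion`), and a zero of the trace form is a zero of `h`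
(`Tr (ι_v p) = 2p`, characteristic `0`).

* §1 `OscillatorStandingData.form_add_left ∕ _right`, `form_smul_left ∕ _right`, `conj_form`,
  `exists_quadraticForm_trace_form` — for ANY standing data `S : OscillatorStandingData K L m` (`K` a field, `L` a
  commutative `K`-algebra): `S.form` is bi-additive, `K`-bilinear, `c`-hermitian (`c (h(x,y)) = h(y,x)`), and
  `x ↦ Tr_{L/K} h(x, x)` IS a quadratic form over `K` on `Lᵐ` (built as `LinearMap.BilinMap.toQuadraticMap` of the
  `K`-bilinear form `(x, y) ↦ Tr h(x, y)`).
* §2 `LemD1OfPlace.exists_toLocalRing_eq_of_conjLocal_eq` — an element of `E_v` fixed by `c ⊗ 1` lies in `ι_v(F_v)`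
  (coordinates `E_v = F_v ⊕ F_v δ`, `quadraticLocalEquiv`); `LemD1OfPlace.form_self_eq_zero_of_trace_eq_zero` — for the
  standing data at `v` (`LemD1OfPlace.standingData`), `Tr h(x,x) = 0 ⟹ h(x,x) = 0`;
  `LemD1OfPlace.five_le_finrank_pi_localRing` — `dim_{F_v} E_vᵐ = 2m ≥ 6` for `m ≥ 3`.
* §3 (the variable context of `Def411IrreducibleOfLemD1AsPrinted` §LocalData) the three registered stubs of the cell's
  line `b4-isotropy-rank-three`, exact signatures — `Def411WeilCarriers.uInvariant_le_four_adicCompletion` (stub (1), the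
  tree citation), `Def411WeilCarriers.traceForm_anisotropic_of_isAnisotropic` (stub (2)),
  `Def411WeilCarriers.five_le_finrank_localLemD1Data` (stub (3)) — and their composition
  **`Def411WeilCarriers.not_isAnisotropic_localLemD1Data`**: `¬ (localLemD1Data … v).IsAnisotropic` for `n ≥ 3`, i.e.
  `LemD1.IsIsotropic` of its standing data (`isIsotropic_localLemD1Data`, via `LemD1Data.isAnisotropic_iff_not_isIsotropic`).

## References
* [Liu2021] Y. Liu, Camb. J. Math. 9 (2021) = arXiv:2102.11518, App. D Lemma D.1 (1) (l. 5229: «unless `V` is anisotropic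
  (in particular `n = 2`)»), proof l. 5249–5266.
* [MoeglinVignerasWaldspurger1987] C. Mœglin, M.-F. Vignéras, J.-L. Waldspurger, LNM 1291, Chap. 1 I.1 (the `F`-space
  underlying a hermitian `D`-space), Chap. 3 IV.2 (stable range).
* [Lam2005] T. Y. Lam, *Introduction to quadratic forms over fields*, GSM 67, Ch. VI Thm 2.12 (`u(F_v) = 4`).
* [Serre1973] J.-P. Serre, *A Course in Arithmetic*, Ch. IV §2.2 Thm 6 (iv) (`ℚ_p`).
* [CasselsFrohlichANT1967] Ch. II §10 (`E ⊗_F F_v`, degree `2`).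
-/

set_option autoImplicit false

noncomputable section

open scoped Matrix Kronecker TensorProduct
open NumberField IsDedekindDomain

/-! ## §1 The hermitian pairing of a standing datum: bilinearity, hermitian symmetry, the trace form -/

namespace Literature.RepresentationTheory.Liu2021.OscillatorStandingData

variable {K L : Type*} [Field K] [CommRing L] [Algebra K L] {m : ℕ} (S : OscillatorStandingData K L m)

/-- `h(x + x', y) = h(x, y) + h(x', y)` for the hermitian pairing `S.form = hermForm c gram` of a standing datum.
[cite: Liu2021, App. D §D.1, arXiv:2102.11518 p. 56 L8] -/
theorem form_add_left (x x' y : Fin m → L) : S.form (x + x') y = S.form x y + S.form x' y := by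
  have h : (⇑S.σ ∘ (x + x')) = ⇑S.σ ∘ x + ⇑S.σ ∘ x' := funext fun i => by
    simp only [Function.comp_apply, Pi.add_apply, map_add]
  simp only [form, Literature.AlgebraicGeometry.ShimuraVarieties.hermForm, h, add_dotProduct]

/-- `h(x, y + y') = h(x, y) + h(x, y')`. [cite: Liu2021, App. D §D.1, arXiv:2102.11518 p. 56 L8] -/
theorem form_add_right (x y y' : Fin m → L) : S.form x (y + y') = S.form x y + S.form x y' := by
  simp only [form, Literature.AlgebraicGeometry.ShimuraVarieties.hermForm, Matrix.mulVec_add, dotProduct_add]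

/-- `h(a • x, y) = a • h(x, y)` for a scalar `a` of the BASE field `K` (`c` is `K`-linear).
[cite: Liu2021, App. D §D.1, arXiv:2102.11518 p. 56 L8] -/
theorem form_smul_left (a : K) (x y : Fin m → L) : S.form (a • x) y = a • S.form x y := by
  have h : (⇑S.σ ∘ (a • x)) = a • (⇑S.σ ∘ x) := funext fun i => by
    simp only [Function.comp_apply, Pi.smul_apply, σ_apply, map_smul]
  simp only [form, Literature.AlgebraicGeometry.ShimuraVarieties.hermForm, h, smul_dotProduct]

/-- `h(x, a • y) = a • h(x, y)` for `a ∈ K`. [cite: Liu2021, App. D §D.1, arXiv:2102.11518 p. 56 L8] -/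
theorem form_smul_right (a : K) (x y : Fin m → L) : S.form x (a • y) = a • S.form x y := by
  simp only [form, Literature.AlgebraicGeometry.ShimuraVarieties.hermForm, Matrix.mulVec_smul, dotProduct_smul]

/-- **hermitian symmetry**: `c (h(x, y)) = h(y, x)` (the Gram matrix is `c`-hermitian, `c` an involution).
[cite: Liu2021, App. D §D.1, arXiv:2102.11518 p. 56 L8] -/
theorem conj_form (x y : Fin m → L) : S.conj (S.form x y) = S.form y x := by
  have hg : ∀ i j, S.conj (S.gram i j) = S.gram j i := fun i j => by
    have h := congrFun (congrFun S.gram_hermitian j) i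
    rwa [Matrix.transpose_apply, Matrix.map_apply] at h
  simp only [form, Literature.AlgebraicGeometry.ShimuraVarieties.hermForm, dotProduct, Matrix.mulVec,
    Function.comp_apply, σ_apply, map_sum, map_mul, S.conj_conj, hg, Finset.mul_sum]
  conv_lhs => rw [Finset.sum_comm]
  exact Finset.sum_congr rfl fun i _ => Finset.sum_congr rfl fun j _ => by ring

/-- `h(x, x)` is fixed by the involution `c`. [cite: Liu2021, App. D §D.1, arXiv:2102.11518 p. 56 L8] -/
theorem conj_form_self (x : Fin m → L) : S.conj (S.form x x) = S.form x x := S.conj_form x x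

/-- **the trace form** `x ↦ Tr_{L/K} h(x, x)` of the hermitian space of a standing datum IS a quadratic form over the base
field `K` on the `K`-space `Lᵐ` (the `F`-space `|W|` underlying a hermitian space, [MoeglinVignerasWaldspurger1987,
Chap. 1 I.1]): the quadratic map of the `K`-bilinear form `(x, y) ↦ Tr_{L/K} h(x, y)`.
[cite: MoeglinVignerasWaldspurger1987, Chap. 1 I.1] -/
theorem exists_quadraticForm_trace_form :
    ∃ Q : QuadraticForm K (Fin m → L), ∀ x, Q x = Algebra.trace K L (S.form x x) := by
  let B : LinearMap.BilinForm K (Fin m → L) :=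
    LinearMap.mk₂ K (fun x y => Algebra.trace K L (S.form x y))
      (fun x x' y => by simp only [form_add_left, map_add])
      (fun a x y => by simp only [form_smul_left, map_smul])
      (fun x y y' => by simp only [form_add_right, map_add])
      (fun a x y => by simp only [form_smul_right, map_smul])
  exact ⟨LinearMap.BilinMap.toQuadraticMap B, fun x => rfl⟩

end Literature.RepresentationTheory.Liu2021.OscillatorStandingData

/-! ## §2 The local model `E_v = E ⊗_F F_v`: `c ⊗ 1`-fixed elements, the trace of `h(x,x)`, the `F_v`-dimension of `E_vᵐ` -/

namespace Literature.NumberTheory.Automorphic.Liu2021.LemD1OfPlace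

open Literature.NumberTheory.Automorphic.UnitaryGroup
open Literature.RepresentationTheory.Liu2021 (OscillatorStandingData)

variable {F : Type} (E : Type) [Field F] [NumberField F] [Field E] [NumberField E] [Algebra F E]
  [Algebra.IsQuadraticExtension F E] (v : HeightOneSpectrum (𝓞 F)) (c : E ≃ₐ[F] E)

/-- **an element of `E_v` fixed by `c ⊗ 1` lies in `ι_v(F_v)`**: in the coordinates `E_v = F_v ⊕ F_v (δ ⊗ 1)`
(`quadraticLocalEquiv`, `c δ = -δ ≠ 0`) the involution is `(p, q) ↦ (p, -q)`, so a fixed element has `2q = 0`, `q = 0`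
(characteristic `0`). [cite: CasselsFrohlichANT1967, Ch. II §10] -/
theorem exists_toLocalRing_eq_of_conjLocal_eq {δ : E} (hcδ : c δ = -δ) (hδ : δ ≠ 0) (x : LocalRing E v)
    (hx : conjLocal E c v x = x) : ∃ p : v.adicCompletion F, toLocalRing E v p = x := by
  haveI : CharZero (v.adicCompletion F) := charZero_of_injective_algebraMap (algebraMap F _).injective
  obtain ⟨⟨p, q⟩, rfl⟩ := (quadraticLocalEquiv E v c hcδ hδ).surjective x
  rw [conjLocal_quadraticLocalEquiv] at hx
  have hq : -q = q := congrArg Prod.snd ((quadraticLocalEquiv E v c hcδ hδ).injective hx)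
  have h2q : (2 : v.adicCompletion F) * q = 0 := by linear_combination -hq
  have hq0 : q = 0 := (mul_eq_zero.1 h2q).resolve_left two_ne_zero
  exact ⟨p, by rw [quadraticLocalEquiv_apply, hq0, map_zero, zero_mul, add_zero]⟩

/-- `Tr_{E_v/F_v} (ι_v p) = 2p` (`[E_v : F_v] = 2`, tree `finrank_localRing`). [cite: CasselsFrohlichANT1967, Ch. II §10] -/
theorem trace_toLocalRing (p : v.adicCompletion F) :
    Algebra.trace (v.adicCompletion F) (LocalRing E v) (toLocalRing E v p) = 2 * p := by
  rw [← algebraMap_localRing_eq, Algebra.trace_algebraMap, finrank_localRing E v, nsmul_eq_mul, Nat.cast_ofNat]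

variable (N : ℕ) (J : Matrix (Fin N) (Fin N) E) {δ : E} (hcδ : c δ = -δ) (hδ : δ ≠ 0) (hN : 2 ≤ N)
  (hJh : (J.map c)ᵀ = J) (hJdet : J.det ≠ 0)

/-- **a zero of the trace form is a zero of the hermitian form** for the standing data at `v`: `h(x, x)` is `c ⊗ 1`-fixed
(`conj_form_self`), hence `= ι_v p` (`exists_toLocalRing_eq_of_conjLocal_eq`), and `Tr (ι_v p) = 2p` with `2 ≠ 0` in
`F_v`. [cite: MoeglinVignerasWaldspurger1987, Chap. 1 I.1] -/
theorem form_self_eq_zero_of_trace_eq_zero (x : Fin N → LocalRing E v)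
    (h : Algebra.trace (v.adicCompletion F) (LocalRing E v) ((standingData E v c N J hcδ hδ hN hJh hJdet).form x x) = 0) :
    (standingData E v c N J hcδ hδ hN hJh hJdet).form x x = 0 := by
  haveI : CharZero (v.adicCompletion F) := charZero_of_injective_algebraMap (algebraMap F _).injective
  have hfix : conjLocal E c v ((standingData E v c N J hcδ hδ hN hJh hJdet).form x x) =
      (standingData E v c N J hcδ hδ hN hJh hJdet).form x x :=
    (standingData E v c N J hcδ hδ hN hJh hJdet).conj_form_self x
  obtain ⟨p, hp⟩ := exists_toLocalRing_eq_of_conjLocal_eq E v c hcδ hδ _ hfix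
  rw [← hp, trace_toLocalRing] at h
  rw [← hp, (mul_eq_zero.1 h).resolve_left two_ne_zero, map_zero]

/-- **`dim_{F_v} (E_vᵐ) = 2m ≥ 5` for `m ≥ 3`** (`[E ⊗_F F_v : F_v] = [E : F] = 2`, tree `finrank_localRing`;
`Module.finrank_pi_fintype`). [cite: CasselsFrohlichANT1967, Ch. II §10] -/
theorem five_le_finrank_pi_localRing {m : ℕ} (hm : 3 ≤ m) :
    5 ≤ Module.finrank (v.adicCompletion F) (Fin m → LocalRing E v) := by
  rw [Module.finrank_pi_fintype, Finset.sum_const, Finset.card_univ, Fintype.card_fin, finrank_localRing E v,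
    smul_eq_mul]
  omega

end Literature.NumberTheory.Automorphic.Liu2021.LemD1OfPlace

/-! ## §3 The three stubs of line `b4-isotropy-rank-three` and their composition, for the as-printed datum at `v` -/

namespace Literature.NumberTheory.Automorphic.Liu2021.Def411WeilCarriers

open scoped Classical RestrictedProduct
open NumberField.mixedEmbedding Filter Set
open Literature.NumberTheory.Automorphic Literature.NumberTheory.Automorphic.UnitaryGroup
open Literature.NumberTheory.Weil1964 Literature.RepresentationTheory
open Literature.RepresentationTheory.HeisenbergGroup
open Literature.GroupTheory.RestrictedProductCharacter
open Literature.NumberTheory Literature.NumberTheory.GelbartRogawski1991 Literature.NumberTheory.GelbartRogawski1991.UnitaryDualPair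
open Literature.NumberTheory.GelbartRogawski1991.UnitaryDualPair.WeilCoinv
open Literature.NumberTheory.Automorphic.Liu2021 Literature.NumberTheory.Automorphic.Liu2021.Def411WeilCarriers

variable (F E : Type) [Field F] [NumberField F] [Field E] [NumberField E] [Algebra F E]
variable (c : E ≃ₐ[F] E) (N : ℕ) {n : ℕ} (e : Fin N × Fin 1 ≃ Fin n)
variable (JV : Matrix (Fin N) (Fin N) E) {TV : Matrix (Fin N) (Fin N) F}
variable [Algebra.IsQuadraticExtension F E] {δ : E} (hcδ : c δ = -δ) (hδ : δ ≠ 0) {d : F}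
  (hd : δ * δ = algebraMap F E d) (hV : TV.IsSymm) (hVd : IsUnit TV.det) (hJV : JV = TV.map (algebraMap F E))
variable (a : Fˣ)
  (𝓢 : LocalSplitting.FinLocalSplittings F E c n hcδ hδ hd (gram F e TV (TW F a)) (isSymm_gram F e hV (isSymm_TW F a))
    (reindex_kronecker_eq_gram_map F E e hJV (JW_eq F E a)))
  (hn : 3 ≤ n)
  (μ : ∀ v : HeightOneSpectrum (𝓞 F), (LocalRing E v)ˣ →* ℂˣ) (hμn : ∀ v x, ‖((μ v x : ℂˣ) : ℂ)‖ = 1)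
  (hμc : ∀ v, Continuous fun x => ((μ v x : ℂˣ) : ℂ))
  (hμF : ∀ (v : HeightOneSpectrum (𝓞 F)) (t : (v.adicCompletion F)ˣ),
    μ v (Units.map (algebraMap (v.adicCompletion F) (LocalRing E v)).toMonoidHom t) = 1 ↔
      ∃ x : (LocalRing E v)ˣ, (x : LocalRing E v) * conjLocal E c v x = algebraMap (v.adicCompletion F) (LocalRing E v) t)
  (χ₁ : UnitaryGroup.finAdelicOne F E c →* ℂˣ) (hχ₁n : ∀ u, ‖((χ₁ u : ℂˣ) : ℂ)‖ = 1) (hχ₁c : Continuous χ₁)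
  (v : HeightOneSpectrum (𝓞 F))

omit [NumberField E] [Algebra.IsQuadraticExtension F E] in
/-- **stub (1) of line `b4-isotropy-rank-three` — the u-invariant of `F_v` is `≤ 4`** [Lam2005, Ch. VI Thm 2.12]: no
quadratic form on an `F_v`-space of dimension `≥ 5` is anisotropic (degenerate forms included).  The TREE theorem
`QuadraticForms.not_anisotropic_of_five_le_finrank_adicCompletion` (Serre IV §2.2 Thm 6 (iv) over every completion,
`QuadraticForms/IsotropicRankFive`, `HilbertSymbolRegularLocal`) in the stub's exact shape. [cite: Lam2005, Ch. VI Thm 2.12] -/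
theorem uInvariant_le_four_adicCompletion :
    ∀ (M : Type) [AddCommGroup M] [Module (v.adicCompletion F) M] (Q : QuadraticForm (v.adicCompletion F) M),
      5 ≤ Module.finrank (v.adicCompletion F) M → ¬ Q.Anisotropic :=
  fun _ _ _ Q hM => QuadraticForms.not_anisotropic_of_five_le_finrank_adicCompletion F v Q hM

/-- **stub (2) of line `b4-isotropy-rank-three` — the trace form of the anisotropic hermitian space of the local datum is
an anisotropic `F_v`-quadratic form on `E_vⁿ`** ([MoeglinVignerasWaldspurger1987, Chap. 1 I.1]: the underlying `F`-space):
`Q x := Tr_{E_v/F_v} h(x, x)` (`OscillatorStandingData.exists_quadraticForm_trace_form`), and `Q x = 0 ⟹ h(x, x) = 0`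
(`LemD1OfPlace.form_self_eq_zero_of_trace_eq_zero`) `⟹ x = 0`. [cite: MoeglinVignerasWaldspurger1987, Chap. 1 I.1] -/
theorem traceForm_anisotropic_of_isAnisotropic :
    (localLemD1Data F E c N e JV hcδ hδ hd hV hVd hJV a 𝓢 hn μ hμn hμc hμF χ₁ hχ₁n hχ₁c v).IsAnisotropic →
      ∃ Q : QuadraticForm (v.adicCompletion F) (Fin n → LocalRing E v), Q.Anisotropic := by
  intro han
  obtain ⟨Q, hQ⟩ :=
    (localLemD1Data F E c N e JV hcδ hδ hd hV hVd hJV a 𝓢 hn μ hμn hμc hμF χ₁ hχ₁n hχ₁c v).S.exists_quadraticForm_trace_form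
  refine ⟨Q, fun x hx => han x ?_⟩
  rw [hQ] at hx
  exact LemD1OfPlace.form_self_eq_zero_of_trace_eq_zero E v c n (Matrix.reindex e e (JV ⊗ₖ JW F E a)) hcδ hδ
    (Nat.le_of_succ_le hn) (reindex_kronecker_JW_hermitian F E c N e JV hV hJV a)
    (det_reindex_kronecker_JW_ne_zero F E N e JV hVd hJV a) x hx

include hn in
/-- **stub (3) of line `b4-isotropy-rank-three` — `dim_{F_v} (E_vⁿ) = 2n ≥ 5`** (`n ≥ 3`, `[E_v : F_v] = 2`).
[cite: CasselsFrohlichANT1967, Ch. II §10] -/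
theorem five_le_finrank_localLemD1Data : 5 ≤ Module.finrank (v.adicCompletion F) (Fin n → LocalRing E v) :=
  LemD1OfPlace.five_le_finrank_pi_localRing E v hn

/-- **[Liu2021, Lem. D.1 (1)]'s isotropy input at `n ≥ 3`: the hermitian space `(E_vⁿ, J_V ⊗ (a))` of the as-printed datum
`localLemD1Data … v` is NOT anisotropic** — the «(in particular `n = 2`)» of the printed exception never occurs for `n ≥ 3`:
the trace form (stub (2)) would be an anisotropic quadratic form over `F_v` in `2n ≥ 6` variables (stub (3)), contradicting
`u(F_v) ≤ 4` (stub (1)).  This is `stub_isotropic_of_three_le` of the cell's line `b4-lemD1-item1-at-v`.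
[cite: Liu2021, App. D Lemma D.1 (1)] [cite: Lam2005, Ch. VI Thm 2.12] -/
theorem not_isAnisotropic_localLemD1Data :
    ¬ (localLemD1Data F E c N e JV hcδ hδ hd hV hVd hJV a 𝓢 hn μ hμn hμc hμF χ₁ hχ₁n hχ₁c v).IsAnisotropic := by
  intro han
  obtain ⟨Q, hQ⟩ := traceForm_anisotropic_of_isAnisotropic F E c N e JV hcδ hδ hd hV hVd hJV a 𝓢 hn μ hμn hμc hμF χ₁ hχ₁n hχ₁c v han
  exact uInvariant_le_four_adicCompletion F v _ Q
    (five_le_finrank_localLemD1Data F E hn v) hQ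

/-- **… equivalently its standing data is ISOTROPIC** in the tree's `LemD1.IsIsotropic` currency (`∃ x ≠ 0, h(x, x) = 0`;
`LemD1Data.isAnisotropic_iff_not_isIsotropic`) — the hypothesis `hiso` of the MVW stable-range fact
`mvw_IV2_rankOne_nonvanishing_of_isotropic` at the Gram matrix `J_V ⊗ (a)`. [cite: Liu2021, App. D Lemma D.1 (1)] -/
theorem isIsotropic_localLemD1Data :
    LemD1.IsIsotropic (localLemD1Data F E c N e JV hcδ hδ hd hV hVd hJV a 𝓢 hn μ hμn hμc hμF χ₁ hχ₁n hχ₁c v).S := by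
  have h := not_isAnisotropic_localLemD1Data F E c N e JV hcδ hδ hd hV hVd hJV a 𝓢 hn μ hμn hμc hμF χ₁ hχ₁n hχ₁c v
  rwa [LemD1Data.isAnisotropic_iff_not_isIsotropic, not_not] at h

end Literature.NumberTheory.Automorphic.Liu2021.Def411WeilCarriers

end
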